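import Literature.NumberTheory.Transcendental.ZeroEstDerivForms
import Literature.NumberTheory.Transcendental.ZeroEstNullstellensatz
import HarnessLib

/-!
# Zero estimates on commutative algebraic groups, VII: special closure and the ideals `∂^T_Γ(P)`

Topic `Literature/NumberTheory/Transcendental`. Seventh module of the discharge of
`Literature.NumberTheory.Transcendental.philippon1986_std` through D. Roy's exposition of
Philippon's zero estimate (Nesterenko–Philippon (eds.), LNM 1752, Ch. 11) for an abstract analytic
group model `M : AnalyticGroupModel V N`. Roy's §2.3 and §3.2 made global:

* **Special closure** `M.specialClosure I = I^*` (Def. 2.1: the contraction of `I` from the local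
  rings at the points of the cone `G̃`; here `{Q ; ∀ a, ∃ B homogeneous, F_B(a) ≠ 0, B Q ∈ I}`):
  an ideal containing `I`, idempotent, monotone, homogeneous when `I` is, with the same zero set in
  `G`, pointwise saturated; orders of vanishing of its members are those of members of `I`
  (`VanishesToOrder.of_mem_specialClosure`); **minimal primes of a special ideal are relevant**
  (`isRelevant_of_mem_minimalPrimes_specialClosure`).
* **Sumsets** `sumset S k = Σ(k)` (Philippon's `Σ(k) = {σ₁ + ⋯ + σ_k}`).
* **The ideals `∂^T_Γ(P)`** attached to a form `P`, a set of translations `Γ ⊆ V`, a subspace `W`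
  and an order `T`: `M.dIdeal W P Γ T = (𝔊 + (derivForm α γ x k P ; α, γ ∈ Γ, x ∈ W, k ≤ T))^*`
  — Roy's `∂^T_Γ((P))` with Prop. 3.6 (iv) taken as the DEFINITION (Philippon's original
  definition, Déf. 4.2), legitimate by `ZeroEstDerivForms.lean`. It is homogeneous, special,
  contains `𝔊`, is generated modulo `𝔊` by forms of degree `c·D` — and:
  **Prop. 3.6 (iii)** (`zeroSet_dIdeal`): `Z_G(∂^T_Γ(P)) = {a ; F_P vanishes to order > T along W
  at a + γ for all γ ∈ Γ}`; **orders of members** (`VanishesToOrder.of_mem_dIdeal`, the part of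
  Prop. 3.6 (ii) the zero estimate uses): if `F_P` vanishes to order `K > T` along `W` at all
  `a + γ`, `γ ∈ Γ`, then every member of `∂^T_Γ(P)` vanishes to order `K - T` along `W` at `a`.

Everything is PROVED; no named facts.

## References

* Yu. V. Nesterenko, P. Philippon (eds.), *Introduction to Algebraic Independence Theory*,
  LNM 1752, Springer 2001, Ch. 11 (D. Roy), Def. 2.1, Def. 3.5, Prop. 3.6, Thm. 4.1 (`Σ(k)`).
  [NesterenkoPhilippon2001]
* P. Philippon, *Lemmes de zéros dans les groupes algébriques commutatifs*, Bull. Soc. Math.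
  France 114 (1986), 355–383, Déf. 4.2, Prop. 4.3–4.4. [Philippon1986]
-/

noncomputable section

open MvPolynomial Set Filter Topology
open scoped Pointwise

namespace Literature.NumberTheory.Transcendental

namespace AnalyticGroupModel

variable {V : Type*} [NormedAddCommGroup V] [NormedSpace ℂ V] {N : ℕ} (M : AnalyticGroupModel V N)

attribute [local instance] MvPolynomial.gradedAlgebra

/-! ### Special closure (Roy Def. 2.1) -/

/-- **The special closure `I^*`** of an ideal: the polynomials `Q` such that at every point `a` of
`G` some form `B` with `F_B(a) ≠ 0` multiplies `Q` into `I` (the contraction of `I` from the local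
rings of the cone at its points off the origin). [cite: NesterenkoPhilippon2001, Ch. 11 Def. 2.1] -/
def specialClosure (I : Ideal (MvPolynomial (Fin (N + 1)) ℂ)) : Ideal (MvPolynomial (Fin (N + 1)) ℂ) where
  carrier := {Q | ∀ a : V, ∃ B : MvPolynomial (Fin (N + 1)) ℂ, (∃ d, B.IsHomogeneous d) ∧ M.F B a ≠ 0 ∧ B * Q ∈ I}
  zero_mem' := fun a => ⟨1, ⟨0, isHomogeneous_one _ _⟩, by simp [F], by simp⟩
  add_mem' := by
    intro P Q hP hQ a
    obtain ⟨B₁, ⟨d₁, hB₁⟩, h₁, hP₁⟩ := hP a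
    obtain ⟨B₂, ⟨d₂, hB₂⟩, h₂, hQ₂⟩ := hQ a
    refine ⟨B₁ * B₂, ⟨_, hB₁.mul hB₂⟩, by simpa using mul_ne_zero h₁ h₂, ?_⟩
    rw [mul_add]
    refine I.add_mem ?_ ?_
    · rw [show B₁ * B₂ * P = B₂ * (B₁ * P) by ring]; exact I.mul_mem_left _ hP₁
    · rw [mul_assoc]; exact I.mul_mem_left _ hQ₂
  smul_mem' := by
    intro c Q hQ a
    obtain ⟨B, hB, h, hBQ⟩ := hQ a
    exact ⟨B, hB, h, by rw [smul_eq_mul, mul_left_comm]; exact I.mul_mem_left c hBQ⟩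

/-- Membership in `I^*`. [folklore] -/
theorem mem_specialClosure_iff {I : Ideal (MvPolynomial (Fin (N + 1)) ℂ)} {Q : MvPolynomial (Fin (N + 1)) ℂ} :
    Q ∈ M.specialClosure I ↔
      ∀ a : V, ∃ B : MvPolynomial (Fin (N + 1)) ℂ, (∃ d, B.IsHomogeneous d) ∧ M.F B a ≠ 0 ∧ B * Q ∈ I :=
  Iff.rfl

/-- `I ⊆ I^*`. [folklore] -/
theorem le_specialClosure (I : Ideal (MvPolynomial (Fin (N + 1)) ℂ)) : I ≤ M.specialClosure I :=
  fun Q hQ a => ⟨1, ⟨0, isHomogeneous_one _ _⟩, by simp [F], by simpa using hQ⟩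

/-- `I ↦ I^*` is monotone. [folklore] -/
theorem specialClosure_mono {I J : Ideal (MvPolynomial (Fin (N + 1)) ℂ)} (h : I ≤ J) :
    M.specialClosure I ≤ M.specialClosure J := fun Q hQ a => by
  obtain ⟨B, hB, hBa, hBQ⟩ := hQ a
  exact ⟨B, hB, hBa, h hBQ⟩

/-- **Pointwise saturation**: if at every point some form non-vanishing there multiplies `Q` into
`I^*`, then `Q ∈ I^*`. [folklore] -/
theorem mem_specialClosure_of_forall {I : Ideal (MvPolynomial (Fin (N + 1)) ℂ)} {Q : MvPolynomial (Fin (N + 1)) ℂ}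
    (h : ∀ a : V, ∃ B : MvPolynomial (Fin (N + 1)) ℂ, (∃ d, B.IsHomogeneous d) ∧ M.F B a ≠ 0 ∧
      B * Q ∈ M.specialClosure I) : Q ∈ M.specialClosure I := by
  intro a
  obtain ⟨B, ⟨d, hB⟩, hBa, hBQ⟩ := h a
  obtain ⟨B', ⟨d', hB'⟩, hB'a, hB'BQ⟩ := hBQ a
  exact ⟨B' * B, ⟨_, hB'.mul hB⟩, by simpa using mul_ne_zero hB'a hBa, by rwa [mul_assoc]⟩

/-- `(I^*)^* = I^*`. [cite: NesterenkoPhilippon2001, Ch. 11 §2.3] -/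
theorem specialClosure_specialClosure (I : Ideal (MvPolynomial (Fin (N + 1)) ℂ)) :
    M.specialClosure (M.specialClosure I) = M.specialClosure I :=
  le_antisymm (fun _ hQ => M.mem_specialClosure_of_forall hQ) (M.le_specialClosure _)

/-- **`Z_G(I^*) = Z_G(I)`.** [cite: NesterenkoPhilippon2001, Ch. 11 §2.3] -/
theorem zeroSet_specialClosure (I : Ideal (MvPolynomial (Fin (N + 1)) ℂ)) :
    M.zeroSet (M.specialClosure I) = M.zeroSet (I : Set (MvPolynomial (Fin (N + 1)) ℂ)) := by
  refine Subset.antisymm (M.zeroSet_antitone (M.le_specialClosure I)) fun a ha Q hQ => ?_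
  obtain ⟨B, ⟨d, hB⟩, hBa, hBQ⟩ := hQ a
  have hc : ∀ c : ℂ, c ≠ 0 → eval (c • M.pt a) Q = 0 := by
    intro c hc
    have := ha _ hBQ c
    rw [map_mul, M.eval_smul_pt hB] at this
    exact (mul_eq_zero.mp this).resolve_left (mul_ne_zero (pow_ne_zero _ hc) hBa)
  intro c
  by_cases hc0 : c = 0
  · subst hc0
    exact eq_zero_of_forall_ne_zero (analyticOnNhd_eval_line Q (M.pt a)).continuous hc
  · exact hc c hc0

/-- **`I^*` is homogeneous when `I` is.** [cite: NesterenkoPhilippon2001, Ch. 11 §2.3] -/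
theorem isHomogeneous_specialClosure {I : Ideal (MvPolynomial (Fin (N + 1)) ℂ)}
    (hI : I.IsHomogeneous (homogeneousSubmodule (Fin (N + 1)) ℂ)) :
    (M.specialClosure I).IsHomogeneous (homogeneousSubmodule (Fin (N + 1)) ℂ) := by
  intro e Q hQ
  rw [← DirectSum.Decomposition.decompose'_eq, decomposition.decompose'_apply]
  intro a
  obtain ⟨B, ⟨d, hB⟩, hBa, hBQ⟩ := hQ a
  refine ⟨B, ⟨d, hB⟩, hBa, ?_⟩
  -- `(B Q)_{d+e} = B Q_e`
  have : homogeneousComponent (d + e) (B * Q) = B * homogeneousComponent e Q := by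
    classical
    conv_lhs => rw [← sum_homogeneousComponent Q, Finset.mul_sum, map_sum]
    rw [Finset.sum_eq_single e]
    · rw [homogeneousComponent_of_mem (hB.mul (homogeneousComponent_isHomogeneous e Q)), if_pos rfl]
    · intro b _ hb
      rw [homogeneousComponent_of_mem (hB.mul (homogeneousComponent_isHomogeneous b Q)), if_neg]
      omega
    · intro he
      rw [Finset.mem_range, not_lt] at he
      rw [homogeneousComponent_eq_zero e Q (by omega), mul_zero, map_zero]
  rw [← this]
  exact homogeneousComponent_mem_of_mem hI hBQ _

/-- **Orders of vanishing pass to the special closure**: if every member of `I` vanishes to order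
`T` along `W` at `a` then so does every member of `I^*`. [cite: NesterenkoPhilippon2001, Ch. 11 Prop. 3.8 Step 1] -/
theorem VanishesToOrder.of_mem_specialClosure {I : Ideal (MvPolynomial (Fin (N + 1)) ℂ)} {W : Submodule ℂ V}
    {a : V} {T : ℕ} (hI : ∀ Q ∈ I, VanishesToOrder W (M.F Q) a T) {Q : MvPolynomial (Fin (N + 1)) ℂ}
    (hQ : Q ∈ M.specialClosure I) : VanishesToOrder W (M.F Q) a T := by
  obtain ⟨B, -, hBa, hBQ⟩ := hQ a
  intro x hx
  have h := hI _ hBQ x hx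
  have heq : (fun t : ℂ => M.F (B * Q) (a + t • x)) = fun t => M.F B (a + t • x) * M.F Q (a + t • x) := by
    funext t; simp
  rw [heq] at h
  exact (forall_iteratedDeriv_mul_eq_zero_iff_of_ne_zero (M.analyticAt_F_line Q a x 0)
    (M.analyticAt_F_line B a x 0) (by simpa using hBa) T).mp h

/-- **Minimal primes of a special ideal are relevant** (they have zeros in `G`).
[cite: NesterenkoPhilippon2001, Ch. 11 Def. 2.1 (I^* and its primary components)] -/
theorem isRelevant_of_mem_minimalPrimes_specialClosure {I : Ideal (MvPolynomial (Fin (N + 1)) ℂ)}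
    {𝔮 : Ideal (MvPolynomial (Fin (N + 1)) ℂ)} (h𝔮 : 𝔮 ∈ (M.specialClosure I).minimalPrimes) :
    M.IsRelevant 𝔮 := by
  classical
  by_contra hirr
  simp only [IsRelevant, not_exists, not_and, not_not] at hirr
  haveI := h𝔮.1.1
  set J := M.specialClosure I with hJ
  have hfin := Ideal.finite_minimalPrimes_of_isNoetherianRing _ J
  set others := hfin.toFinset.erase 𝔮 with hothers
  have hnot : ¬ (others.inf id ≤ 𝔮) := by
    rw [Ideal.IsPrime.inf_le' inferInstance]
    rintro ⟨𝔮', h𝔮', hle⟩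
    rw [hothers, Finset.mem_erase, Set.Finite.mem_toFinset] at h𝔮'
    have : 𝔮' = 𝔮 := le_antisymm hle (h𝔮.2 ⟨h𝔮'.2.1.1, h𝔮'.2.1.2⟩ hle)
    exact h𝔮'.1 this
  obtain ⟨f, hf, hf𝔮⟩ := Set.not_subset.mp hnot
  -- `f u ∈ ⋂ minimal primes = √J` for every boundary form `u`
  have hfu : ∀ u ∈ M.bdry, ∃ m : ℕ, (f * u) ^ (m + 1) ∈ J := by
    intro u hu
    have hrad : f * u ∈ J.radical := by
      rw [← Ideal.sInf_minimalPrimes, Submodule.mem_sInf]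
      intro 𝔮' h𝔮'
      by_cases heq : 𝔮' = 𝔮
      · rw [heq]; exact 𝔮.mul_mem_left _ (hirr u hu)
      · have hmem : 𝔮' ∈ others := by
          rw [hothers, Finset.mem_erase, Set.Finite.mem_toFinset]; exact ⟨heq, h𝔮'⟩
        exact Ideal.mul_mem_right _ 𝔮' ((Finset.inf_le (f := id) hmem) hf)
    obtain ⟨m, hm⟩ := hrad
    refine ⟨m, ?_⟩
    rw [pow_succ]
    exact J.mul_mem_right _ hm
  choose! m hm using hfu
  set mm := M.bdry.sup m + 1 with hmm
  -- `f^{mm} ∈ J` by pointwise saturation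
  have hfmm : f ^ mm ∈ J := by
    refine M.mem_specialClosure_of_forall fun a => ?_
    obtain ⟨u, hu, hua⟩ := M.exists_bdry_ne_zero a
    obtain ⟨d, -, hud⟩ := M.isHomogeneous_bdry u hu
    have hFu : M.F u a ≠ 0 := hua
    refine ⟨u ^ mm, ⟨_, hud.pow mm⟩, by simp only [F, map_pow]; exact pow_ne_zero mm hFu, ?_⟩
    have hle : m u + 1 ≤ mm := by
      have := Finset.le_sup (f := m) hu; omega
    have h1 : (f * u) ^ mm ∈ J := by
      rw [← Nat.sub_add_cancel hle, pow_add]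
      exact J.mul_mem_left _ (hm u hu)
    rw [mul_pow, mul_comm] at h1
    exact h1
  exact hf𝔮 ((inferInstance : 𝔮.IsPrime).mem_of_pow_mem mm (h𝔮.1.2 hfmm))

/-! ### Sumsets `Σ(k)` -/

omit [NormedSpace ℂ V] M in
/-- **`Σ(k) = {σ₁ + ⋯ + σ_k ; σᵢ ∈ S}`** (`Σ(0) = {0}`). [cite: NesterenkoPhilippon2001, Ch. 11 Thm. 4.1] -/
def sumset (S : Set V) (k : ℕ) : Set V := {v | ∃ f : Fin k → V, (∀ i, f i ∈ S) ∧ v = ∑ i, f i}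

omit [NormedSpace ℂ V] M in
/-- `Σ(0) = {0}`. [folklore] -/
theorem sumset_zero (S : Set V) : sumset S 0 = {0} := by
  ext v
  simp only [sumset, Finset.univ_eq_empty, Finset.sum_empty, mem_setOf_eq, mem_singleton_iff]
  exact ⟨fun ⟨_, _, h⟩ => h, fun h => ⟨Fin.elim0, fun i => i.elim0, h⟩⟩

omit [NormedSpace ℂ V] M in
/-- `Σ(k) + S ⊆ Σ(k+1)`. [folklore] -/
theorem add_mem_sumset_succ {S : Set V} {k : ℕ} {v s : V} (hv : v ∈ sumset S k) (hs : s ∈ S) :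
    v + s ∈ sumset S (k + 1) := by
  obtain ⟨f, hf, rfl⟩ := hv
  refine ⟨Fin.snoc f s, fun i => ?_, ?_⟩
  · refine Fin.lastCases ?_ (fun i' => ?_) i
    · simpa using hs
    · simpa using hf i'
  · rw [Fin.sum_univ_castSucc]; simp

omit [NormedSpace ℂ V] M in
/-- `S ⊆ Σ(1)`. [folklore] -/
theorem subset_sumset_one (S : Set V) : S ⊆ sumset S 1 := fun s hs => by
  have := add_mem_sumset_succ (S := S) (k := 0) (v := 0) (by rw [sumset_zero]; rfl) hs
  simpa using this

omit [NormedSpace ℂ V] M in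
/-- `Σ(k) ⊆ Σ(k+1)` when `0 ∈ S`. [folklore] -/
theorem sumset_subset_succ {S : Set V} (h0 : (0 : V) ∈ S) (k : ℕ) : sumset S k ⊆ sumset S (k + 1) :=
  fun v hv => by simpa using add_mem_sumset_succ hv h0

omit [NormedSpace ℂ V] M in
/-- `Σ(k) ⊆ Σ(k')` for `k ≤ k'` when `0 ∈ S`. [folklore] -/
theorem sumset_mono {S : Set V} (h0 : (0 : V) ∈ S) {k k' : ℕ} (h : k ≤ k') : sumset S k ⊆ sumset S k' := by
  induction h with
  | refl => exact Subset.rfl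
  | step _ ih => exact ih.trans (sumset_subset_succ h0 _)

omit [NormedSpace ℂ V] M in
/-- `0 ∈ Σ(k)` when `0 ∈ S`. [folklore] -/
theorem zero_mem_sumset {S : Set V} (h0 : (0 : V) ∈ S) (k : ℕ) : (0 : V) ∈ sumset S k :=
  sumset_mono h0 (Nat.zero_le k) (by rw [sumset_zero]; rfl)

omit [NormedSpace ℂ V] M in
/-- `Σ(k) + Σ(j) ⊆ Σ(k + j)`. [folklore] -/
theorem add_mem_sumset_add {S : Set V} {k j : ℕ} {v w : V} (hv : v ∈ sumset S k) (hw : w ∈ sumset S j) :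
    v + w ∈ sumset S (k + j) := by
  obtain ⟨f, hf, rfl⟩ := hv
  obtain ⟨g, hg, rfl⟩ := hw
  refine ⟨Fin.append f g, fun i => ?_, ?_⟩
  · refine Fin.addCases (fun i' => ?_) (fun i' => ?_) i
    · simpa using hf i'
    · simpa using hg i'
  · rw [Fin.sum_univ_add]; simp

omit [NormedSpace ℂ V] M in
/-- A finite `S` has finite sumsets. [folklore] -/
theorem sumset_finite {S : Set V} (hS : S.Finite) (k : ℕ) : (sumset S k).Finite := by
  have : sumset S k = (fun f : Fin k → V => ∑ i, f i) '' (Set.univ.pi fun _ => S) := by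
    ext v
    simp only [sumset, mem_setOf_eq, mem_image, Set.mem_pi, Set.mem_univ, forall_const]
    constructor
    · rintro ⟨f, hf, rfl⟩; exact ⟨f, hf, rfl⟩
    · rintro ⟨f, hf, rfl⟩; exact ⟨f, hf, rfl⟩
  rw [this]
  exact (Set.Finite.pi fun _ => hS).image _

/-! ### The ideals `∂^T_Γ(P)` -/

section DIdeal

variable (W : Submodule ℂ V)

/-- The generators: derived forms of `P` for all laws, translations in `Γ`, directions in `W` and
orders `≤ T`. [cite: NesterenkoPhilippon2001, Ch. 11 Prop. 3.6 (iv) (the set F)] -/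
def derivGens (P : MvPolynomial (Fin (N + 1)) ℂ) (Γ : Set V) (T : ℕ) : Set (MvPolynomial (Fin (N + 1)) ℂ) :=
  {Q | ∃ (α : Fin M.nLaw) (γ : V) (x : V) (k : ℕ), γ ∈ Γ ∧ x ∈ W ∧ k ≤ T ∧ Q = M.derivForm α γ x k P}

/-- **`∂^T_Γ(P) = (𝔊 + (derivGens))^*`.** [cite: NesterenkoPhilippon2001, Ch. 11 Def. 3.5, Prop. 3.6 (iv)]
[cite: Philippon1986, Déf. 4.2] -/
def dIdeal (P : MvPolynomial (Fin (N + 1)) ℂ) (Γ : Set V) (T : ℕ) : Ideal (MvPolynomial (Fin (N + 1)) ℂ) :=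
  M.specialClosure (M.relIdeal ⊔ Ideal.span (M.derivGens W P Γ T))

variable {W}

/-- Generators are forms of degree `c·D`. [folklore] -/
theorem isHomogeneous_of_mem_derivGens {P : MvPolynomial (Fin (N + 1)) ℂ} {D : ℕ} (hP : P.IsHomogeneous D)
    {Γ : Set V} {T : ℕ} {Q : MvPolynomial (Fin (N + 1)) ℂ} (hQ : Q ∈ M.derivGens W P Γ T) :
    Q.IsHomogeneous (M.lawDeg * D) := by
  obtain ⟨α, γ, x, k, -, -, -, rfl⟩ := hQ
  exact M.isHomogeneous_derivForm α γ x k hP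

/-- `𝔊 ⊆ ∂^T_Γ(P)`. [folklore] -/
theorem relIdeal_le_dIdeal (P : MvPolynomial (Fin (N + 1)) ℂ) (Γ : Set V) (T : ℕ) :
    M.relIdeal ≤ M.dIdeal W P Γ T :=
  le_sup_left.trans (M.le_specialClosure _)

/-- The generators lie in `∂^T_Γ(P)`. [folklore] -/
theorem derivGens_subset_dIdeal (P : MvPolynomial (Fin (N + 1)) ℂ) (Γ : Set V) (T : ℕ) :
    M.derivGens W P Γ T ⊆ M.dIdeal W P Γ T :=
  (Ideal.subset_span.trans (le_sup_right : Ideal.span _ ≤ M.relIdeal ⊔ Ideal.span _)).trans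
    (M.le_specialClosure _)

/-- `∂^T_Γ(P)` is special. [folklore] -/
theorem specialClosure_dIdeal (P : MvPolynomial (Fin (N + 1)) ℂ) (Γ : Set V) (T : ℕ) :
    M.specialClosure (M.dIdeal W P Γ T) = M.dIdeal W P Γ T :=
  M.specialClosure_specialClosure _

/-- `∂^T_Γ(P)` is homogeneous. [folklore] -/
theorem isHomogeneous_dIdeal {P : MvPolynomial (Fin (N + 1)) ℂ} {D : ℕ} (hP : P.IsHomogeneous D)
    (Γ : Set V) (T : ℕ) : (M.dIdeal W P Γ T).IsHomogeneous (homogeneousSubmodule (Fin (N + 1)) ℂ) := by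
  refine M.isHomogeneous_specialClosure (Ideal.IsHomogeneous.sup M.isHomogeneous_relIdeal ?_)
  exact Ideal.homogeneous_span _ _ fun Q hQ => ⟨_, M.isHomogeneous_of_mem_derivGens hP hQ⟩

/-- Monotonicity of `∂^T_Γ(P)` in `Γ` and `T`. [folklore] -/
theorem dIdeal_mono (P : MvPolynomial (Fin (N + 1)) ℂ) {Γ Γ' : Set V} (hΓ : Γ ⊆ Γ') {T T' : ℕ} (hT : T ≤ T') :
    M.dIdeal W P Γ T ≤ M.dIdeal W P Γ' T' := by
  refine M.specialClosure_mono (sup_le_sup_left (Ideal.span_mono ?_) _)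
  rintro Q ⟨α, γ, x, k, hγ, hx, hk, rfl⟩
  exact ⟨α, γ, x, k, hΓ hγ, hx, hk.trans hT, rfl⟩

/-- `Z_G(I ⊔ J) = Z_G(I) ∩ Z_G(J)`. [folklore] -/
theorem zeroSet_sup (I J : Ideal (MvPolynomial (Fin (N + 1)) ℂ)) :
    M.zeroSet ((I ⊔ J : Ideal _) : Set (MvPolynomial (Fin (N + 1)) ℂ)) = M.zeroSet I ∩ M.zeroSet J := by
  ext a
  constructor
  · intro h
    exact ⟨M.zeroSet_antitone (fun Q hQ => (le_sup_left : I ≤ I ⊔ J) hQ) h,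
      M.zeroSet_antitone (fun Q hQ => (le_sup_right : J ≤ I ⊔ J) hQ) h⟩
  · rintro ⟨hI, hJ⟩ Q hQ c
    obtain ⟨P, hP, P', hP', rfl⟩ := Submodule.mem_sup.mp hQ
    rw [map_add, hI P hP c, hJ P' hP' c, add_zero]

/-- **Prop. 3.6 (iii): the zero set of `∂^T_Γ(P)`** is the set of `a` such that `F_P` vanishes to
order `> T` along `W` at `a + γ` for every `γ ∈ Γ`. [cite: NesterenkoPhilippon2001, Ch. 11 Prop. 3.6 (iii)] -/
theorem zeroSet_dIdeal {P : MvPolynomial (Fin (N + 1)) ℂ} {D : ℕ} (hP : P.IsHomogeneous D) (Γ : Set V) (T : ℕ) :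
    M.zeroSet (M.dIdeal W P Γ T) = {a | ∀ γ ∈ Γ, VanishesToOrder W (M.F P) (a + γ) (T + 1)} := by
  rw [dIdeal, zeroSet_specialClosure, zeroSet_sup, zeroSet_relIdeal, univ_inter, zeroSet_span]
  ext a
  rw [M.mem_zeroSet_iff_of_isHomogeneous (fun Q hQ => ⟨_, M.isHomogeneous_of_mem_derivGens hP hQ⟩)]
  simp only [mem_setOf_eq]
  constructor
  · intro h γ hγ
    obtain ⟨α, hα⟩ := M.exists_lam_ne_zero a γ
    rw [M.vanishesToOrder_iff_F_derivForm hP hα]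
    intro x hx k hk
    exact h _ ⟨α, γ, x, k, hγ, hx, Nat.lt_succ_iff.mp hk, rfl⟩
  · rintro h Q ⟨α, γ, x, k, hγ, hx, hk, rfl⟩
    have hv := VanishesToOrder.derivForm M hP hx (Nat.lt_succ_of_le hk) (h γ hγ) α
    exact hv.apply_eq_zero (by omega)

/-- **Orders of members of `∂^T_Γ(P)`** (the half of Prop. 3.6 (ii) used in the zero estimate):
if `F_P` vanishes to order `K > T` along `W` at `a + γ` for all `γ ∈ Γ`, then every member of
`∂^T_Γ(P)` vanishes to order `K - T` along `W` at `a`. [cite: NesterenkoPhilippon2001, Ch. 11 Prop. 3.6 (ii), Lemma 3.3] -/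
theorem VanishesToOrder.of_mem_dIdeal {P : MvPolynomial (Fin (N + 1)) ℂ} {D : ℕ} (hP : P.IsHomogeneous D)
    {Γ : Set V} {T K : ℕ} (hTK : T < K) {a : V} (ha : ∀ γ ∈ Γ, VanishesToOrder W (M.F P) (a + γ) K)
    {Q : MvPolynomial (Fin (N + 1)) ℂ} (hQ : Q ∈ M.dIdeal W P Γ T) : VanishesToOrder W (M.F Q) a (K - T) := by
  refine VanishesToOrder.of_mem_specialClosure M (fun Q' hQ' => ?_) hQ
  obtain ⟨g, hg, s, hs, rfl⟩ := Submodule.mem_sup.mp hQ'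
  refine VanishesToOrder.F_add M ?_ ?_
  · -- members of `𝔊` have `F ≡ 0`
    have h0 : M.F g = 0 := by
      funext w
      rw [show M.F g w = M.F (∑ i ∈ Finset.range (g.totalDegree + 1), homogeneousComponent i g) w by
        rw [sum_homogeneousComponent], F, map_sum]
      refine Finset.sum_eq_zero fun i _ => ?_
      exact (M.mem_relIdeal_iff_of_isHomogeneous (homogeneousComponent_isHomogeneous i g)).mp
        (M.homogeneousComponent_mem_vanishing hg i) w
    intro x _ k _
    rw [h0]
    rw [show (fun t : ℂ => (0 : V → ℂ) (a + t • x)) = 0 from rfl, iteratedDeriv_const_zero]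
  · refine VanishesToOrder.of_mem_span M (fun Q'' hQ'' => ?_) hs
    obtain ⟨α, γ, x, k, hγ, hx, hk, rfl⟩ := hQ''
    exact (VanishesToOrder.derivForm M hP hx (lt_of_le_of_lt hk hTK) (ha γ hγ) α).mono (by omega)

/-- Monotonicity of the zero sets of `∂^T_Γ(P)` (the chain `X_1 ⊇ X_2 ⊇ ⋯` of Thm. 4.1).
[cite: NesterenkoPhilippon2001, Ch. 11 Thm. 4.1 (proof)] -/
theorem zeroSet_dIdeal_antitone {P : MvPolynomial (Fin (N + 1)) ℂ} {D : ℕ} (hP : P.IsHomogeneous D)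
    {Γ Γ' : Set V} (hΓ : Γ ⊆ Γ') {T T' : ℕ} (hT : T ≤ T') :
    M.zeroSet (M.dIdeal W P Γ' T') ⊆ M.zeroSet (M.dIdeal W P Γ T) := by
  rw [M.zeroSet_dIdeal hP, M.zeroSet_dIdeal hP]
  intro a ha γ hγ
  exact (ha γ (hΓ hγ)).mono (by omega)

end DIdeal

end AnalyticGroupModel

end Literature.NumberTheory.Transcendental
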